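import Literature.NumberTheory.Rogawski1990.FinExplicitTransferFactorConjLeft
import HarnessLib

/-!
# `Δ‴_v(γ_H, yγ′y⁻¹) = Δ‴_v(γ_H, γ′)`: Rogawski's explicit transfer factor at a finite place `v` is a class function of
# `γ′ ∈ G′_v = U(H′)(L⁺_v)` (node N1f-r of `F0/P3a/T6b-TREE.md` §9; the `hr` hypothesis of ★ `finExplicitTransferFactor` DISCHARGED)

Topic `NumberTheory/Rogawski1990`; namespace `Literature.NumberTheory.Rogawski1990`.  THEOREMS ONLY (no `def`, no named fact, no `sorry`,
no instance, no notation); sibling of ★ `FinExplicitTransferFactor.lean` (typ-T6b (g0), node N1f), which it imports (since ED. 2 through the other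
sibling ★ `FinExplicitTransferFactorConjLeft.lean`, node N1f-l) and nothing else of the tree.
Cell `pub/hodgecm-mathlib`, F0∕P3a, topic T6 (#72 side), seat F0P3a-p01 (g7) (DESK TABLE #3 row (2)).  The finite-place twin of ★
`ArchExplicitTransferFactorConjRight.lean` (B-p12 (g25), node N1a-r), whose rank-one algebra it transposes from `ℂ` to the commutative ring
`E_v = L ⊗ L⁺_v = ∏_{w ∣ v} L_w` (★ `UnitaryGroup.LocalRing L v`).  HONEST LABEL: HC_CM is proved only modulo the printed citations («named
inputs remaining 2») until rung 0 closes; this file proves nothing of them — it turns the second conjugation-invariance HYPOTHESIS `hr` of ★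
`finExplicitTransferFactor L v H′ μ hl hr : LocalTransferFactor L H′ v` into a theorem (its type TOKEN FOR TOKEN), so that together with
node N1f-l (`hl`, sibling file of F0P3a-p08) the explicit finite collection ★ `finExplicitCollection L H′ μ …` — the `Δ` slot of the #72 letter
★ `GlobalTransferWithCartanKappaFormula` — carries no hypothesis.

THE MATHEMATICS (Rogawski 1990 §4.9 p. 55, §4.3 p. 43, §14.6 p. 242; Langlands–Shelstad 1987 §2: a transfer factor depends only on the conjugacy
class of `γ′` in `G′`).  `Δ‴_v(γ_H, γ′) = τ_v(γ_H) · D_{G∕H,v}(γ_H) · κ_v(γ_H, γ′)` on matching pairs `ι_v(γ_H) ↔ γ′` and `0` off them (★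
`finExplicitDelta`); only `κ_v(γ_H, γ′) ∈ {−1, 0, 1}` sees `γ′` (★ `finKappaAt`): it is `0` iff `P_v = χ_g(γ′) = γ′² − tr(g)γ′ + det(g) = 0`
(★ `finEigenlineProjector`), `+1` at a place `v` split in `L`, and at a non-split `v` the norm test «`x_v ∈ N(E_v^×)`» on the relative position
`x_v = pᴴ · H′_v · p` (★ `finRelPos`: the `H′_v`-value of the first non-zero column `p` of `P_v`).
* §1 (algebra over a commutative ring `R` with a ring endomorphism `σ`): the pattern `ι(g, u) = (g₀₀ 0 g₀₁; 0 u 0; g₁₀ 0 g₁₁)` satisfies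
  `ι² − tr(g)·ι + det(g)·1 = χ_g(u)·E₂₂` (Cayley–Hamilton on the `g`-block) — a rank `≤ 1` matrix `p qᵀ`; conjugating a quadratic polynomial
  in a matrix; the `σ`-hermitian value of the `j`-th column of `p qᵀ` is `q_j σ(q_j) · x₀(p)`, `x₀(p) = Σ_{i,k} σ(p_i) H_{ik} p_k`; and
  `x₀(y p) = x₀(p)` whenever `σ(y)ᵀ H y = H`; finally «`t σ(t) x₀` is a unit norm `z σ(z)`» does not depend on the unit `t`.
* §2 (at the finite place `v`): `P_v(γ_H, yγ′y⁻¹) = y · P_v(γ_H, γ′) · y⁻¹` (a polynomial in `γ′`); `σ(y)ᵀ H′_v y = H′_v` (membership in ★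
  `UnitaryGroup.cmDatum … |>.Local v`); ON A MATCHING PAIR `P_v = (c e₂)(χ_g(u) e₂ᵀ c⁻¹)` for any conjugator `c ∈ GL₃(E_v)` with
  `γ′ = c ι_v(γ_H) c⁻¹` (★ `isLocalNormPair_iff` = ambient conjugacy, ★ `coe_endoEmbLocal`, ★ `coe_endoGL_eq`) — no regularity hypothesis;
  at a NON-SPLIT `v` (one place `w ∣ v`, so every non-zero element of `E_v = L_w` is a unit) the relative position of a non-zero rank-one
  `P_v = p qᵀ` is `t σ(t) · x₀(p)` for a UNIT `t` (the entry `q_j` of the first non-zero column), whence the norm test of ★ `finKappaAt` takes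
  the same value at `γ′` and at `yγ′y⁻¹` (`x₀(y p) = x₀(p)`); at a split `v` and off the support of `P_v` the two ★ unfolding lemmas decide.
* §3: `κ_v(γ_H, yγ′y⁻¹) = κ_v(γ_H, γ′)` on matching pairs (`finKappaAt_conj_right`), matching is a class function of `γ′`
  (`isLocalNormPair_conj_right`, ★ `Corresponds.of_isStablyConj_right`), hence the head **`finExplicitDelta_conj_right`** — the type of `hr`
  TOKEN FOR TOKEN — and the record `finExplicitTransferFactor_Δ_eq_of_conj_right` of the factor built from it.

EDITION LOG.  ED. 1 (★ p827714): §1–§3, importing ★ `FinExplicitTransferFactor` only.  ED. 2 (this text, append-only; the import is now the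
sibling ★ `FinExplicitTransferFactorConjLeft` (F0P3a-p08 (g8), p827517: N1f-l = ★ `finExplicitDelta_conj_left`), through which N1f comes): §4 —
`finExplicitDelta_conj_right_all` (the `hr` binder of ★ `finExplicitCollection`, all `v` at once) and the records `finExplicitTransferFactor_Δ_eq`,
`finExplicitCollection_Δ_eq`: **print's `Δ‴_v` and the finite collection `(Δ‴_v)_v` — the `Δ` slot of the #72 letter — are UNCONDITIONAL**
★ `LocalTransferFactor`s, `finExplicitTransferFactor L v H′ μ (finExplicitDelta_conj_left L v H′ μ) (finExplicitDelta_conj_right L v H′ μ)` and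
`finExplicitCollection L H′ μ (finExplicitDelta_conj_left_all L H′ μ) (finExplicitDelta_conj_right_all L H′ μ)` (no new definition).

## References
* [Rogawski1990] J. D. Rogawski, *Automorphic Representations of Unitary Groups in Three Variables*, Ann. of Math. Stud. 123 (1990): §4.3 p. 43
  (transfer factors are class functions in each variable; `Φ^κ`), §4.9 p. 55 (`τ`, `D_{G∕H}`, `Δ_{G∕H}`, (4.9.1)), §3.5 Prop. 3.5.2 (c) p. 29
  (`H¹(F, T)` on the τ-stable factors; the degree-one factor), §14.6 p. 242 (`Δ″_v`, «`κ(γ, ψ_v(i(γ)))` is equal to `±1`»).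
* [LanglandsShelstad1987] R. P. Langlands, D. Shelstad, *On the definition of transfer factors*, Math. Ann. 278 (1987), §1–§2 (`inv(γ_H, γ_G)`
  depends only on the conjugacy class of `γ_G`; `κ`), §4.2.
-/

set_option autoImplicit false

noncomputable section

open NumberField IsDedekindDomain Matrix Polynomial
open Literature.NumberTheory.GaloisRepresentations
open scoped MatrixGroups

namespace Literature.NumberTheory.Rogawski1990

open Literature.NumberTheory.Automorphic

/-! ## §1 Rank-one algebra over a commutative ring with a ring endomorphism `σ` -/

section RankOne

variable {R : Type*} [CommRing R]

/-- **The pattern `ι(g, u) = (g₀₀ 0 g₀₁; 0 u 0; g₁₀ 0 g₁₁)` is killed by `χ_g` off the middle entry** (Cayley–Hamilton for the `2 × 2` block), over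
any commutative ring: `ι² − tr(g)·ι + det(g)·1 = χ_g(u) · E₂₂ = (χ_g(u) e₂)(e₂)ᵀ`, a matrix of rank `≤ 1`. [folklore] -/
private theorem endoPattern_sq_sub_smul_add_smul_eq_vecMulVec (g : Matrix (Fin 2) (Fin 2) R) (u : R) :
    (!![g 0 0, 0, g 0 1; 0, u, 0; g 1 0, 0, g 1 1] * !![g 0 0, 0, g 0 1; 0, u, 0; g 1 0, 0, g 1 1] -
        g.trace • !![g 0 0, 0, g 0 1; 0, u, 0; g 1 0, 0, g 1 1] + g.det • (1 : Matrix (Fin 3) (Fin 3) R)) =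
      vecMulVec (Pi.single 1 (u * u - g.trace * u + g.det)) (Pi.single 1 1) := by
  ext i j
  rw [Matrix.trace_fin_two, Matrix.det_fin_two]
  fin_cases i <;> fin_cases j <;>
    simp [vecMulVec_apply] <;> ring

/-- Conjugating a quadratic polynomial in a matrix: `(cιc′)² − t·(cιc′) + d·1 = c (ι² − tι + d·1) c′` when `c′c = 1 = cc′`. [folklore] -/
private theorem conj_sq_sub_smul_add_smul_one_of_mul_eq_one {m : Type*} [Fintype m] [DecidableEq m] (c c' ι : Matrix m m R) (t d : R)
    (h1 : c' * c = 1) (h2 : c * c' = 1) :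
    c * ι * c' * (c * ι * c') - t • (c * ι * c') + d • (1 : Matrix m m R) = c * (ι * ι - t • ι + d • 1) * c' := by
  have hsq : c * ι * c' * (c * ι * c') = c * (ι * ι) * c' := by
    calc c * ι * c' * (c * ι * c') = c * ι * (c' * c) * ι * c' := by simp only [Matrix.mul_assoc]
      _ = c * (ι * ι) * c' := by rw [h1, Matrix.mul_one, Matrix.mul_assoc c ι ι]
  rw [hsq]
  simp only [Matrix.mul_sub, Matrix.mul_add, Matrix.sub_mul, Matrix.add_mul, Matrix.mul_smul, Matrix.smul_mul, Matrix.mul_one, h2]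

/-- A conjugate `c P c′` vanishes iff `P` does, when `c′ c = 1`. [folklore] -/
private theorem conj_eq_zero_iff_of_mul_eq_one {m : Type*} [Fintype m] [DecidableEq m] (c c' P : Matrix m m R)
    (h1 : c' * c = 1) : c * P * c' = 0 ↔ P = 0 := by
  constructor
  · intro h
    calc P = (c' * c) * P * (c' * c) := by rw [h1, Matrix.one_mul, Matrix.mul_one]
      _ = c' * (c * P * c') * c := by simp only [Matrix.mul_assoc]
      _ = 0 := by rw [h, Matrix.mul_zero, Matrix.zero_mul]
  · intro h
    rw [h, Matrix.mul_zero, Matrix.zero_mul]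

/-- **The `σ`-hermitian value of the `j`-th column of a rank-one matrix**: for `P = p qᵀ`,
`Σ_{i,k} σ(P_{ij}) H_{ik} P_{kj} = q_j σ(q_j) · Σ_{i,k} σ(p_i) H_{ik} p_k`. [folklore] -/
private theorem sum_sum_map_vecMulVec_mul_mul_vecMulVec {n : Type*} [Fintype n] (σ : R →+* R) (H : Matrix n n R) (p q : n → R) (j : n) :
    (∑ i, ∑ k, σ (vecMulVec p q i j) * H i k * vecMulVec p q k j) =
      q j * σ (q j) * ∑ i, ∑ k, σ (p i) * H i k * p k := by
  simp only [vecMulVec_apply, map_mul, Finset.mul_sum]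
  refine Finset.sum_congr rfl fun i _ => Finset.sum_congr rfl fun k _ => ?_
  ring

/-- **`x₀(y p) = x₀(p)` for `σ`-unitary `y`**: if `σ(y)ᵀ H y = H` then `Σ_{i,k} σ((yp)_i) H_{ik} (yp)_k = Σ_{i,k} σ(p_i) H_{ik} p_k`. [folklore] -/
private theorem sum_sum_map_mulVec_mul_mul_mulVec_of_unitary {n : Type*} [Fintype n] (σ : R →+* R) (H y : Matrix n n R)
    (hy : (y.map σ)ᵀ * H * y = H) (p : n → R) :
    (∑ i, ∑ k, σ ((y *ᵥ p) i) * H i k * (y *ᵥ p) k) = ∑ i, ∑ k, σ (p i) * H i k * p k := by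
  have key : ∀ r : n → R, (∑ i, ∑ k, σ (r i) * H i k * r k) = (σ ∘ r) ⬝ᵥ (H *ᵥ r) := by
    intro r
    simp only [dotProduct, mulVec, Function.comp_apply, Finset.mul_sum, mul_assoc]
  have hσ : (σ ∘ (y *ᵥ p)) = (y.map σ) *ᵥ (σ ∘ p) := by
    funext i
    exact RingHom.map_mulVec σ y p i
  rw [key, key, hσ, ← vecMul_transpose, ← dotProduct_mulVec, mulVec_mulVec, mulVec_mulVec, hy]

/-- **The unit norm test does not see unit rescalings**: for units `t, t′`, `t σ(t) x` is of the form `z σ(z)` with `z` a unit iff `t′ σ(t′) x`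
is. [folklore] -/
private theorem exists_isUnit_mul_map_mul_iff (σ : R →+* R) {t t' : R} (ht : IsUnit t) (ht' : IsUnit t') (x : R) :
    (∃ z : R, IsUnit z ∧ t * σ t * x = z * σ z) ↔ (∃ z : R, IsUnit z ∧ t' * σ t' * x = z * σ z) := by
  have aux : ∀ {s s' : R}, IsUnit s → IsUnit s' →
      (∃ z : R, IsUnit z ∧ s * σ s * x = z * σ z) → (∃ z : R, IsUnit z ∧ s' * σ s' * x = z * σ z) := by
    intro s s' hs hs' ⟨z, hz, h⟩
    obtain ⟨su, rfl⟩ := hs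
    refine ⟨z * s' * ↑su⁻¹, (hz.mul hs').mul (Units.isUnit _), ?_⟩
    have e1 : (su : R) * ↑su⁻¹ = 1 := Units.mul_inv su
    have e2 : σ (su : R) * σ ↑su⁻¹ = 1 := by rw [← map_mul, e1, map_one]
    calc s' * σ s' * x = s' * σ s' * x * (((su : R) * ↑su⁻¹) * (σ (su : R) * σ ↑su⁻¹)) := by rw [e1, e2, mul_one, mul_one]
      _ = ((su : R) * σ su * x) * (s' * σ s') * (↑su⁻¹ * σ ↑su⁻¹) := by ring
      _ = (z * σ z) * (s' * σ s') * (↑su⁻¹ * σ ↑su⁻¹) := by rw [h]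
      _ = z * s' * ↑su⁻¹ * σ (z * s' * ↑su⁻¹) := by rw [map_mul, map_mul]; ring
  exact ⟨aux ht ht', aux ht' ht⟩

end RankOne

/-! ## §2 At the finite place `v`: `P_v` under conjugation of `γ′`, unitarity of `y`, rank one on matching pairs, the non-split norm test -/

section ConjRight

variable (L : Type) [Field L] [NumberField L] [IsCMField L] (v : HeightOneSpectrum (𝓞 ↥(maximalRealSubfield L)))
  (H' : Matrix (Fin 3) (Fin 3) L)
  (a : (UnitaryGroup.cmDatum L 2 (Matrix.of fun i j : Fin 2 => if i.val + j.val + 1 = 2 then (1 : L) else 0)).Local v ×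
      (UnitaryGroup.cmDatum L 1 (Matrix.of fun i j : Fin 1 => if i.val + j.val + 1 = 1 then (1 : L) else 0)).Local v)
  (b y : (UnitaryGroup.cmDatum L 3 H').Local v)

/-- `y⁻¹ · y = 1` in `M₃(E_v)` (bookkeeping). [folklore] -/
private theorem localUnits_inv_mul : ((y.val⁻¹).val : Matrix (Fin 3) (Fin 3) (UnitaryGroup.LocalRing L v)) * y.val.val = 1 := by
  rw [← Units.val_mul, inv_mul_cancel, Units.val_one]

/-- `y · y⁻¹ = 1` in `M₃(E_v)` (bookkeeping). [folklore] -/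
private theorem localUnits_mul_inv : (y.val.val : Matrix (Fin 3) (Fin 3) (UnitaryGroup.LocalRing L v)) * (y.val⁻¹).val = 1 := by
  rw [← Units.val_mul, mul_inv_cancel, Units.val_one]

/-- **`P_v(γ_H, yγ′y⁻¹) = y · P_v(γ_H, γ′) · y⁻¹`** — `P_v` is a polynomial in `γ′`. [cite: Rogawski1990, §4.9 p. 55] -/
theorem finEigenlineProjector_conj_right :
    finEigenlineProjector L v H' a (y * b * y⁻¹) =
      (y.val.val : Matrix (Fin 3) (Fin 3) (UnitaryGroup.LocalRing L v)) * finEigenlineProjector L v H' a b * (y.val⁻¹).val := by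
  have hcoe : (y * b * y⁻¹).val = y.val * b.val * y.val⁻¹ := rfl
  dsimp only [finEigenlineProjector]
  rw [hcoe, Units.val_mul, Units.val_mul]
  exact conj_sq_sub_smul_add_smul_one_of_mul_eq_one _ _ _ _ _ (localUnits_inv_mul L v H' y) (localUnits_mul_inv L v H' y)

/-- `P_v(γ_H, yγ′y⁻¹) = 0` iff `P_v(γ_H, γ′) = 0`. [cite: Rogawski1990, §4.9 p. 55] -/
theorem finEigenlineProjector_conj_right_eq_zero_iff :
    finEigenlineProjector L v H' a (y * b * y⁻¹) = 0 ↔ finEigenlineProjector L v H' a b = 0 := by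
  rw [finEigenlineProjector_conj_right]
  exact conj_eq_zero_iff_of_mul_eq_one _ _ _ (localUnits_inv_mul L v H' y)

/-- **`σ(y)ᵀ · H′_v · y = H′_v`** for `y ∈ G′_v = U(H′)(L⁺_v)` — membership in ★ `UnitaryGroup.cmDatum L 3 H′ |>.Local v` (= ★ `UnitaryGroup.«local»`,
an ★ `unitaryGroupOfForm` for `σ = c ⊗ 1` = ★ `UnitaryGroup.conjLocal` and the local form ★ `(adelicForm L 3 H′).map (adeleToLocal L v)`).
[cite: Rogawski1990, §4.9 p. 54] -/
theorem map_conjLocal_transpose_mul_localForm_mul :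
    ((y.val.val : Matrix (Fin 3) (Fin 3) (UnitaryGroup.LocalRing L v)).map (UnitaryGroup.conjLocal L (IsCMField.complexConj L) v))ᵀ *
        (UnitaryGroup.adelicForm L 3 H').map (UnitaryGroup.adeleToLocal L v) * y.val.val =
      (UnitaryGroup.adelicForm L 3 H').map (UnitaryGroup.adeleToLocal L v) :=
  mem_unitaryGroupOfForm_iff.mp y.2

/-- **On a matching pair `P_v` has rank `≤ 1`**: `ι_v(γ_H) ↔ γ′` means `γ′ = c ι_v(γ_H) c⁻¹` in `GL₃(E_v)` (★ `isLocalNormPair_iff`, ★ `Corresponds` =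
ambient conjugacy), and `χ_g` kills the `g`-block of the pattern `ι_v(g, u)` (★ `coe_endoEmbLocal`, ★ `coe_endoGL_eq`), so
`P_v = χ_g(γ′) = (c e₂) · (χ_g(u) e₂ᵀ c⁻¹)` — no regularity or semisimplicity hypothesis. [cite: Rogawski1990, §4.9 p. 55; §3.5 Prop. 3.5.2 (c) p. 29] -/
theorem finEigenlineProjector_eq_vecMulVec_of_isLocalNormPair (h : IsLocalNormPair L H' v a b) :
    ∃ p q : Fin 3 → UnitaryGroup.LocalRing L v, finEigenlineProjector L v H' a b = vecMulVec p q := by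
  rw [isLocalNormPair_iff] at h
  obtain ⟨c, hc⟩ := isConj_iff.1 h
  have hmat : (b.val.val : Matrix (Fin 3) (Fin 3) (UnitaryGroup.LocalRing L v)) =
      (c.val : Matrix (Fin 3) (Fin 3) (UnitaryGroup.LocalRing L v)) * (endoEmbLocal L v a).val.val * (c⁻¹).val := by
    rw [← Units.val_mul, ← Units.val_mul, hc]
  have h1 : ((c⁻¹).val : Matrix (Fin 3) (Fin 3) (UnitaryGroup.LocalRing L v)) * c.val = 1 := by
    rw [← Units.val_mul, inv_mul_cancel, Units.val_one]
  have h2 : (c.val : Matrix (Fin 3) (Fin 3) (UnitaryGroup.LocalRing L v)) * (c⁻¹).val = 1 := by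
    rw [← Units.val_mul, mul_inv_cancel, Units.val_one]
  set g : Matrix (Fin 2) (Fin 2) (UnitaryGroup.LocalRing L v) := a.1.val.val with hg
  set u : Matrix (Fin 1) (Fin 1) (UnitaryGroup.LocalRing L v) := a.2.val.val with hu
  have hι : ((endoEmbLocal L v a).val.val : Matrix (Fin 3) (Fin 3) (UnitaryGroup.LocalRing L v)) =
      !![g 0 0, 0, g 0 1; 0, u 0 0, 0; g 1 0, 0, g 1 1] := by
    rw [coe_endoEmbLocal, coe_endoGL_eq]
  refine ⟨(c.val : Matrix (Fin 3) (Fin 3) (UnitaryGroup.LocalRing L v)) *ᵥ Pi.single 1 (u 0 0 * u 0 0 - g.trace * u 0 0 + g.det),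
    Pi.single 1 1 ᵥ* ((c⁻¹).val : Matrix (Fin 3) (Fin 3) (UnitaryGroup.LocalRing L v)), ?_⟩
  dsimp only [finEigenlineProjector]
  rw [← hg, hmat, hι, conj_sq_sub_smul_add_smul_one_of_mul_eq_one _ _ _ _ _ h1 h2,
    endoPattern_sq_sub_smul_add_smul_eq_vecMulVec, mul_vecMulVec, vecMulVec_mul]

omit [IsCMField L] in
/-- **At a non-split `v` every non-zero element of `E_v = ∏_{w ∣ v} L_w` is a unit** (one place `w` above `v`: `E_v = L_w` is a field).
[cite: CasselsFrohlichANT1967, Ch. II §10] -/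
theorem isUnit_localRing_of_ne_zero_of_subsingleton (hv : Subsingleton (UnitaryGroup.PlacesOver L v))
    {x : UnitaryGroup.LocalRing L v} (hx : x ≠ 0) : IsUnit x := by
  rw [Pi.isUnit_iff]
  obtain ⟨w₀, hw₀⟩ := Function.ne_iff.1 hx
  intro w
  rw [Subsingleton.elim w w₀]
  exact isUnit_iff_ne_zero.2 hw₀

/-- **The column values of a rank-one `P_v`**: if `P_v(γ_H, γ′) = p qᵀ` then `x_j = q_j σ(q_j) · x₀(p)` for every column `j`, with
`x₀(p) = Σ_{i,k} σ(p_i) (H′_v)_{ik} p_k` (★ `finColumnFormValue`). [cite: Rogawski1990, §3.5 Prop. 3.5.2 (c) p. 29] -/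
theorem finColumnFormValue_eq_of_eq_vecMulVec {p q : Fin 3 → UnitaryGroup.LocalRing L v}
    (hP : finEigenlineProjector L v H' a b = vecMulVec p q) (j : Fin 3) :
    finColumnFormValue L v H' a b j =
      q j * UnitaryGroup.conjLocal L (IsCMField.complexConj L) v (q j) *
        ∑ i : Fin 3, ∑ k : Fin 3, UnitaryGroup.conjLocal L (IsCMField.complexConj L) v (p i) *
          ((UnitaryGroup.adelicForm L 3 H').map (UnitaryGroup.adeleToLocal L v)) i k * p k := by
  unfold finColumnFormValue
  rw [hP]
  exact sum_sum_map_vecMulVec_mul_mul_vecMulVec _ _ p q j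

open scoped Classical in
/-- **The relative position of a non-zero rank-one `P_v` at a non-split `v`** is `t σ(t) · x₀(p)` for a UNIT `t` (the entry `q_j` at the first
non-zero column `j` of `P_v = p qᵀ`; ★ `finRelPos`). [cite: Rogawski1990, §3.5 Prop. 3.5.2 (c) p. 29; §4.3 p. 43] [cite: LanglandsShelstad1987, §1] -/
theorem finRelPos_eq_of_eq_vecMulVec (hv : Subsingleton (UnitaryGroup.PlacesOver L v)) {p q : Fin 3 → UnitaryGroup.LocalRing L v}
    (hP : finEigenlineProjector L v H' a b = vecMulVec p q) (hne : finEigenlineProjector L v H' a b ≠ 0) :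
    ∃ t : UnitaryGroup.LocalRing L v, IsUnit t ∧
      finRelPos L v H' a b = t * UnitaryGroup.conjLocal L (IsCMField.complexConj L) v t *
        ∑ i : Fin 3, ∑ k : Fin 3, UnitaryGroup.conjLocal L (IsCMField.complexConj L) v (p i) *
          ((UnitaryGroup.adelicForm L 3 H').map (UnitaryGroup.adeleToLocal L v)) i k * p k := by
  have hex : ∃ j : Fin 3, ∃ i : Fin 3, finEigenlineProjector L v H' a b i j ≠ 0 := by
    by_contra hcon
    exact hne (Matrix.ext fun i j => not_not.1 fun hij => hcon ⟨j, i, hij⟩)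
  unfold finRelPos
  rw [dif_pos hex]
  obtain ⟨i, hi⟩ := Fin.find_spec hex
  refine ⟨q (Fin.find _ hex), ?_, finColumnFormValue_eq_of_eq_vecMulVec L v H' a b hP _⟩
  refine isUnit_localRing_of_ne_zero_of_subsingleton L v hv fun h0 => hi ?_
  rw [congrFun (congrFun hP i) (Fin.find _ hex), vecMulVec_apply, h0, mul_zero]

/-! ## §3 `κ_v`, matching and `Δ‴_v` are class functions of `γ′` -/

/-- **`κ_v(γ_H, yγ′y⁻¹) = κ_v(γ_H, γ′)` on matching pairs**: `P_v ↦ y P_v y⁻¹` preserves `P_v = 0`; at a split `v` both signs are `+1`; at a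
non-split `v` the relative positions are `t σ(t) x₀(p)` and `t′ σ(t′) x₀(y p) = t′ σ(t′) x₀(p)` for units `t, t′` (rank one on matching pairs,
`σ(y)ᵀ H′_v y = H′_v`), so the norm test agrees. [cite: Rogawski1990, §14.6 p. 242; §4.3 p. 43] [cite: LanglandsShelstad1987, §2] -/
theorem finKappaAt_conj_right (h : IsLocalNormPair L H' v a b) :
    finKappaAt L v H' a (y * b * y⁻¹) = finKappaAt L v H' a b := by
  by_cases hP : finEigenlineProjector L v H' a b = 0
  · rw [finKappaAt_of_projector_eq_zero L v H' a hP,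
      finKappaAt_of_projector_eq_zero L v H' a ((finEigenlineProjector_conj_right_eq_zero_iff L v H' a b y).2 hP)]
  · have hP' : finEigenlineProjector L v H' a (y * b * y⁻¹) ≠ 0 :=
      fun h0 => hP ((finEigenlineProjector_conj_right_eq_zero_iff L v H' a b y).1 h0)
    by_cases hv : Subsingleton (UnitaryGroup.PlacesOver L v)
    · obtain ⟨p, q, hpq⟩ := finEigenlineProjector_eq_vecMulVec_of_isLocalNormPair L v H' a b h
      have hpq' : finEigenlineProjector L v H' a (y * b * y⁻¹) =
          vecMulVec ((y.val.val : Matrix (Fin 3) (Fin 3) (UnitaryGroup.LocalRing L v)) *ᵥ p)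
            (q ᵥ* ((y.val⁻¹).val : Matrix (Fin 3) (Fin 3) (UnitaryGroup.LocalRing L v))) := by
        rw [finEigenlineProjector_conj_right, hpq, mul_vecMulVec, vecMulVec_mul]
      obtain ⟨t, ht, hr⟩ := finRelPos_eq_of_eq_vecMulVec L v H' a b hv hpq hP
      obtain ⟨t', ht', hr'⟩ := finRelPos_eq_of_eq_vecMulVec L v H' a (y * b * y⁻¹) hv hpq' hP'
      rw [sum_sum_map_mulVec_mul_mul_mulVec_of_unitary _ _ _ (map_conjLocal_transpose_mul_localForm_mul L v H' y)] at hr'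
      unfold finKappaAt
      rw [if_neg hP, if_neg hP', if_neg (not_not.2 hv), if_neg (not_not.2 hv), hr, hr',
        exists_isUnit_mul_map_mul_iff (UnitaryGroup.conjLocal L (IsCMField.complexConj L) v) ht' ht]
    · rw [finKappaAt_of_not_subsingleton L v H' a hP hv, finKappaAt_of_not_subsingleton L v H' a hP' hv]

/-- **`ι_v(γ_H) ↔ yγ′y⁻¹` iff `ι_v(γ_H) ↔ γ′`** — matching only sees the (stable) class of `γ′` (★ `Corresponds.of_isStablyConj_right`).
[cite: Rogawski1990, §14.1 p. 232; §4.3 p. 43] -/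
theorem isLocalNormPair_conj_right : IsLocalNormPair L H' v a (y * b * y⁻¹) ↔ IsLocalNormPair L H' v a b := by
  rw [isLocalNormPair_iff, isLocalNormPair_iff]
  have hst : IsStablyConj (UnitaryGroup.conjLocal L (IsCMField.complexConj L) v)
      ((UnitaryGroup.adelicForm L 3 H').map (UnitaryGroup.adeleToLocal L v)) b (y * b * y⁻¹) :=
    isStablyConj_iff.2 ⟨y.val, rfl⟩
  exact ⟨fun h => h.of_isStablyConj_right hst.symm, fun h => h.of_isStablyConj_right hst⟩

end ConjRight

section Head

variable (L : Type) [Field L] [NumberField L] [IsCMField L] (v : HeightOneSpectrum (𝓞 ↥(maximalRealSubfield L)))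
  (H' : Matrix (Fin 3) (Fin 3) L)

open scoped Classical in
/-- **N1f-r: `Δ‴_v(γ_H, yγ′y⁻¹) = Δ‴_v(γ_H, γ′)`** — invariance under conjugation of `γ′` in `G′_v = U(H′)(L⁺_v)` (the `conj_right` field of ★
`TransferFactorData`; the type of the hypothesis `hr` of ★ `finExplicitTransferFactor` ∕ ★ `finExplicitCollection`, token for token).
[cite: Rogawski1990, §4.9 p. 55; §4.3 p. 43; §14.6 p. 242] -/
theorem finExplicitDelta_conj_right (μ : HeckeCharacter L) :
    ∀ (a : (UnitaryGroup.cmDatum L 2 (Matrix.of fun i j : Fin 2 => if i.val + j.val + 1 = 2 then (1 : L) else 0)).Local v ×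
      (UnitaryGroup.cmDatum L 1 (Matrix.of fun i j : Fin 1 => if i.val + j.val + 1 = 1 then (1 : L) else 0)).Local v)
      (b y : (UnitaryGroup.cmDatum L 3 H').Local v),
      finExplicitDelta L v H' a μ (y * b * y⁻¹) = finExplicitDelta L v H' a μ b := by
  intro a b y
  by_cases h : IsLocalNormPair L H' v a b
  · rw [finExplicitDelta_of_isLocalNormPair L v H' a μ ((isLocalNormPair_conj_right L v H' a b y).2 h),
      finExplicitDelta_of_isLocalNormPair L v H' a μ h, finKappaAt_conj_right L v H' a b y h]
  · rw [finExplicitDelta_of_not_isLocalNormPair L v H' a μ (fun h' => h ((isLocalNormPair_conj_right L v H' a b y).1 h')),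
      finExplicitDelta_of_not_isLocalNormPair L v H' a μ h]

open scoped Classical in
/-- **`Δ‴_v` with the `conj_right` hypothesis discharged**: for any witness `hl` of the remaining `conj_left` invariance (node N1f-l), the factor
`finExplicitTransferFactor L v H′ μ hl (finExplicitDelta_conj_right L v H′ μ)` is an ★ `LocalTransferFactor L H′ v` whose `Δ` is `Δ‴_v`
(a record — no new definition). [cite: Rogawski1990, §4.9 p. 55; §4.3 p. 43] -/
theorem finExplicitTransferFactor_Δ_eq_of_conj_right (μ : HeckeCharacter L)
    (hl : ∀ (a : (UnitaryGroup.cmDatum L 2 (Matrix.of fun i j : Fin 2 => if i.val + j.val + 1 = 2 then (1 : L) else 0)).Local v ×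
      (UnitaryGroup.cmDatum L 1 (Matrix.of fun i j : Fin 1 => if i.val + j.val + 1 = 1 then (1 : L) else 0)).Local v)
      (b : (UnitaryGroup.cmDatum L 3 H').Local v)
      (x : (UnitaryGroup.cmDatum L 2 (Matrix.of fun i j : Fin 2 => if i.val + j.val + 1 = 2 then (1 : L) else 0)).Local v ×
      (UnitaryGroup.cmDatum L 1 (Matrix.of fun i j : Fin 1 => if i.val + j.val + 1 = 1 then (1 : L) else 0)).Local v),
      finExplicitDelta L v H' (x * a * x⁻¹) μ b = finExplicitDelta L v H' a μ b)
    (a : (UnitaryGroup.cmDatum L 2 (Matrix.of fun i j : Fin 2 => if i.val + j.val + 1 = 2 then (1 : L) else 0)).Local v ×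
      (UnitaryGroup.cmDatum L 1 (Matrix.of fun i j : Fin 1 => if i.val + j.val + 1 = 1 then (1 : L) else 0)).Local v)
    (b : (UnitaryGroup.cmDatum L 3 H').Local v) :
    (finExplicitTransferFactor L v H' μ hl (finExplicitDelta_conj_right L v H' μ)).Δ a b = finExplicitDelta L v H' a μ b :=
  rfl

end Head

/-! ## §4 (ED. 2, append-only) Print's `Δ‴_v` and the finite collection `(Δ‴_v)_v` as UNCONDITIONAL ★ `LocalTransferFactor`s -/

section Unconditional

variable (L : Type) [Field L] [NumberField L] [IsCMField L] (H' : Matrix (Fin 3) (Fin 3) L)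

/-- **The `hr` binder of ★ `finExplicitCollection`, all finite places at once**: `∀ v a b y, Δ‴_v(a, yby⁻¹) = Δ‴_v(a, b)` (twin of ★
`finExplicitDelta_conj_left_all`). [cite: Rogawski1990, §4.9 p. 55; §4.3 p. 43] -/
theorem finExplicitDelta_conj_right_all (μ : HeckeCharacter L) :
    ∀ (v : HeightOneSpectrum (𝓞 ↥(maximalRealSubfield L)))
      (a : (UnitaryGroup.cmDatum L 2 (Matrix.of fun i j : Fin 2 => if i.val + j.val + 1 = 2 then (1 : L) else 0)).Local v ×
        (UnitaryGroup.cmDatum L 1 (Matrix.of fun i j : Fin 1 => if i.val + j.val + 1 = 1 then (1 : L) else 0)).Local v)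
      (b y : (UnitaryGroup.cmDatum L 3 H').Local v),
      finExplicitDelta L v H' a μ (y * b * y⁻¹) = finExplicitDelta L v H' a μ b :=
  fun v => finExplicitDelta_conj_right L v H' μ

variable (v : HeightOneSpectrum (𝓞 ↥(maximalRealSubfield L)))

open scoped Classical in
/-- **`Δ‴_v` is an unconditional ★ `LocalTransferFactor L H′ v`**: both invariance hypotheses of ★ `finExplicitTransferFactor` are theorems (★
`finExplicitDelta_conj_left`, node N1f-l; ★ `finExplicitDelta_conj_right`, node N1f-r); this records the resulting factor's `Δ` — the term is ★
`finExplicitTransferFactor` applied to the two theorems, no new definition. [cite: Rogawski1990, §4.9 p. 55; §4.3 p. 43; §14.6 p. 242] -/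
theorem finExplicitTransferFactor_Δ_eq (μ : HeckeCharacter L)
    (a : (UnitaryGroup.cmDatum L 2 (Matrix.of fun i j : Fin 2 => if i.val + j.val + 1 = 2 then (1 : L) else 0)).Local v ×
      (UnitaryGroup.cmDatum L 1 (Matrix.of fun i j : Fin 1 => if i.val + j.val + 1 = 1 then (1 : L) else 0)).Local v)
    (b : (UnitaryGroup.cmDatum L 3 H').Local v) :
    (finExplicitTransferFactor L v H' μ (finExplicitDelta_conj_left L v H' μ) (finExplicitDelta_conj_right L v H' μ)).Δ a b =
      finExplicitDelta L v H' a μ b :=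
  rfl

open scoped Classical in
/-- **The explicit finite collection `(Δ‴_v)_v` is unconditional** — the `Δ : ∀ v, LocalTransferFactor L H′ v` slot of the #72 letter ★
`GlobalTransferWithCartanKappaFormula`, built with NO hypothesis as ★ `finExplicitCollection L H′ μ (finExplicitDelta_conj_left_all L H′ μ)
(finExplicitDelta_conj_right_all L H′ μ)`; its member at `v` has `Δ = Δ‴_v` (record). [cite: Rogawski1990, §4.9 p. 55; §14.6 p. 242] -/
theorem finExplicitCollection_Δ_eq (μ : HeckeCharacter L)
    (a : (UnitaryGroup.cmDatum L 2 (Matrix.of fun i j : Fin 2 => if i.val + j.val + 1 = 2 then (1 : L) else 0)).Local v ×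
      (UnitaryGroup.cmDatum L 1 (Matrix.of fun i j : Fin 1 => if i.val + j.val + 1 = 1 then (1 : L) else 0)).Local v)
    (b : (UnitaryGroup.cmDatum L 3 H').Local v) :
    (finExplicitCollection L H' μ (finExplicitDelta_conj_left_all L H' μ) (finExplicitDelta_conj_right_all L H' μ) v).Δ a b =
      finExplicitDelta L v H' a μ b :=
  rfl

end Unconditional

end Literature.NumberTheory.Rogawski1990

end
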